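import Literature.NumberTheory.GaloisRepresentations.PowerSeriesTopNilpotentPadicPowers
import Literature.NumberTheory.GaloisRepresentations.PowerSeriesTopNilpotentIntertwine
import HarnessLib

/-!
# The `(ϖ)`-adic EVALUATION of `p`-adic powers: `((1+T)^c)(a) = (1+a)^c := lim (1+a)^{t_n}` — the weight / character specialisation of a
# group element read in `Λ = S⟦T⟧` (de Shalit I §3.1, III §1.11 (18); Washington §7.1, §13.2: `(1+T) ↦ κ(γ)`, `γ^c ↦ κ(γ)^c`)

The tree's `tEval ha : S⟦T⟧ →+* S` (`PowerSeriesTopNilpotentIntertwine`; `T ↦ a ∈ (ϖ)`, `S` `(ϖ)`-adically complete) reads the weight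
specialisations of the Coleman coordinate module (`LubinTateColemanCoordMomentsLinearTwo`, the scalars `t_v(a_k) = v^{k+1}` at `a_k = γ^{k+1} − 1` of
`LubinTateColemanCoordCoinvariantTwistTwo`), and `tEval ((1+T)^n) = (1+a)^n` for NATURAL `n` (`tEval_one_add_X_pow`).  With the `p`-adic powers
`(1+T)^c = PowerSeries.binomialSeries S c` of `PowerSeriesTopNilpotentPadicPowers` (this seat) one needs their VALUES: THIS file proves
(everything PROVED, 0 sorry, no definitions; `p` any natural number with `(p : S) ∈ (ϖ)` — no primality outside the `ℤ_p`-statements):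

* §1 `geom_sum_sub_natCast_mem_span` (`Σ_{i<p} x^i ≡ p (mod x − 1)`), ★ `pow_natCast_sub_one_mem_pow_succ` (**`x ≡ 1 (mod ϖ^{m+1}) ⟹ x^p ≡ 1 (mod ϖ^{m+2})`**),
  ★ `one_add_pow_pow_sub_one_mem_pow` (**`(1+a)^{pⁿ} ≡ 1 (mod ϖ^{n+1})`** for `a ∈ (ϖ)`), `tEval_one_add_X_pow_pow_sub_one_mem_pow`.
* §2 (`S` a `ℤ_p`-algebra) ★★ **`tEval_binomialSeries_sub_pow_mem`** — `((1+T)^c)(a) ≡ (1+a)^t (mod ϖ^{n+1})` for `c ≡ t (mod pⁿ)`;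
  ★★ **`tEval_binomialSeries_eq_of_forall`** — the value `((1+T)^c)(a)` is the UNIQUE `v ∈ S` with `v ≡ (1+a)^{t_n} (mod ϖ^{n+1})` for naturals `t_n → c`
  ("`v = (1+a)^c`"); `tEval_binomialSeries_add` (`(1+a)^{c+c′} = (1+a)^c (1+a)^{c′}`); ★★ **`tEval_binomialSeries_eq_pow_of_forall`** — if `v = g^c`
  (`g = 1 + a`, congruences) then **`((1+T)^c)(g^k − 1) = v^k`**: the weight-`k` specialisation of the group element `g^c ↦ (1+T)^c` is `(g^c)^k` — the
  consistency `t_v(a_k) = v^{k+1}` ⟷ `t_v = (1+T)^c` of the Coleman lane (`γ^c = v`, `a_k = γ^{k+1} − 1`).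

## References
* E. de Shalit, *Iwasawa theory of elliptic curves with complex multiplication* (1987), Ch. I §3.1; Ch. III §1.11 (18). [deShalit1987]
* L. C. Washington, *Introduction to Cyclotomic Fields*, 2nd ed. (1997), §7.1, §13.2. [Washington1997]
* J.-P. Serre, *A Course in Arithmetic* (1973), Ch. II §3.3 (lifting the exponent). [Serre1973CourseArithmetic]
-/

noncomputable section

namespace Literature.NumberTheory.GaloisRepresentations

namespace LubinTate

open Finset

section PadicPowersEval

variable {S : Type*} [CommRing S] {ϖ : S}

/-! ### §1. Lifting the exponent for `(1+a)^{pⁿ}` -/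

/-- `Σ_{i<p} x^i − p ∈ (x − 1)` (each `x^i − 1` is a multiple of `x − 1`). [cite: Serre1973CourseArithmetic, Ch. II §3.3] -/
theorem geom_sum_sub_natCast_mem_span (x : S) (p : ℕ) : (∑ i ∈ range p, x ^ i) - (p : S) ∈ Ideal.span {x - 1} := by
  have e : (∑ i ∈ range p, x ^ i) - (p : S) = ∑ i ∈ range p, (x ^ i - 1) := by
    rw [sum_sub_distrib, sum_const, card_range, nsmul_eq_mul, mul_one]
  rw [e]
  exact Ideal.sum_mem _ fun i _ => Ideal.mem_span_singleton.mpr (by simpa using sub_dvd_pow_sub_pow x 1 i)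

/-- ★ **`x ≡ 1 (mod ϖ^{m+1}) ⟹ x^p ≡ 1 (mod ϖ^{m+2})`** for a natural number `p` with `(p : S) ∈ (ϖ)`: `x^p − 1 = (x−1)·Σ x^i` and `Σ x^i ≡ p ≡ 0 (mod ϖ)`.
[cite: Serre1973CourseArithmetic, Ch. II §3.3] -/
theorem pow_natCast_sub_one_mem_pow_succ {p : ℕ} (hp : (p : S) ∈ Ideal.span {ϖ}) {x : S} {m : ℕ} (hx : x - 1 ∈ Ideal.span {ϖ ^ (m + 1)}) :
    x ^ p - 1 ∈ Ideal.span {ϖ ^ (m + 2)} := by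
  have hsum : (∑ i ∈ range p, x ^ i) ∈ Ideal.span {ϖ} := by
    have h1 := geom_sum_sub_natCast_mem_span x p
    have h2 : Ideal.span {x - 1} ≤ Ideal.span {ϖ} := by
      rw [Ideal.span_singleton_le_iff_mem]
      exact Ideal.pow_le_self (Nat.succ_ne_zero m) (by rwa [← Ideal.span_singleton_pow] at hx)
    have h3 := add_mem (h2 h1) hp
    rwa [sub_add_cancel] at h3
  rw [← mul_geom_sum x p, pow_succ, ← Ideal.span_singleton_mul_span_singleton]
  exact Ideal.mul_mem_mul hx hsum

/-- ★ **`(1+a)^{pⁿ} − 1 ∈ (ϖ^{n+1})`** for `a ∈ (ϖ)` and `(p : S) ∈ (ϖ)`. [cite: Serre1973CourseArithmetic, Ch. II §3.3] [cite: Washington1997, §7.1] -/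
theorem one_add_pow_pow_sub_one_mem_pow {p : ℕ} (hp : (p : S) ∈ Ideal.span {ϖ}) {a : S} (ha : a ∈ Ideal.span {ϖ}) (n : ℕ) :
    (1 + a) ^ p ^ n - 1 ∈ Ideal.span {ϖ ^ (n + 1)} := by
  induction n with
  | zero => simpa using ha
  | succ n ih =>
    rw [pow_succ p n, pow_mul]
    exact pow_natCast_sub_one_mem_pow_succ hp ih

variable [IsAdicComplete (Ideal.span {ϖ}) S] {a : S} (ha : a ∈ Ideal.span {ϖ})

/-- `((1+T)^{pⁿ} − 1)(a) = (1+a)^{pⁿ} − 1 ∈ (ϖ^{n+1})`. [cite: Washington1997, §7.1, §13.2] -/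
theorem tEval_one_add_X_pow_pow_sub_one_mem_pow {p : ℕ} (hp : (p : S) ∈ Ideal.span {ϖ}) (n : ℕ) :
    tEval ha ((1 + PowerSeries.X : PowerSeries S) ^ p ^ n - 1) ∈ Ideal.span {ϖ ^ (n + 1)} := by
  rw [← tEvalHom_apply, map_sub, map_one, tEvalHom_apply, tEval_one_add_X_pow]
  exact one_add_pow_pow_sub_one_mem_pow hp ha n

/-! ### §2. Values of the binomial series with `p`-adic exponent -/

variable {p : ℕ} [Fact p.Prime] [Algebra ℤ_[p] S]

/-- ★★ **`((1+T)^c)(a) ≡ (1+a)^t (mod ϖ^{n+1})` for `c ≡ t (mod pⁿ)`** (`t ∈ ℕ`, `c ∈ ℤ_p`, `(p : S) ∈ (ϖ)`, `a ∈ (ϖ)`).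
[cite: Washington1997, §7.1, §13.2] [cite: deShalit1987, Ch. I §3.1] -/
theorem tEval_binomialSeries_sub_pow_mem (hp : (p : S) ∈ Ideal.span {ϖ}) {n : ℕ} {c : ℤ_[p]} {t : ℕ}
    (hct : PadicInt.toZModPow n c = (t : ZMod (p ^ n))) :
    tEval ha (PowerSeries.binomialSeries S c) - (1 + a) ^ t ∈ Ideal.span {ϖ ^ (n + 1)} := by
  obtain ⟨q, hq⟩ := exists_binomialSeries_sub_pow_eq_mul (S := S) hct
  have hsub : tEval ha (PowerSeries.binomialSeries S c - (1 + PowerSeries.X) ^ t) =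
      tEval ha (PowerSeries.binomialSeries S c) - (1 + a) ^ t := by
    rw [← tEvalHom_apply, map_sub, tEvalHom_apply, tEvalHom_apply, tEval_one_add_X_pow]
  rw [← hsub, hq, tEval_mul]
  exact Ideal.mul_mem_left _ _ (tEval_one_add_X_pow_pow_sub_one_mem_pow ha hp n)

/-- ★★ **The value `((1+T)^c)(a)` is the unique `v` with `v ≡ (1+a)^{t_n} (mod ϖ^{n+1})` for naturals `t_n ≡ c (mod pⁿ)`, all `n`** — i.e.
`v = (1+a)^c := lim (1+a)^{t_n}` (`S` `(ϖ)`-adically separated). [cite: deShalit1987, Ch. I §3.1] [cite: Washington1997, §13.2] -/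
theorem tEval_binomialSeries_eq_of_forall (hp : (p : S) ∈ Ideal.span {ϖ}) {c : ℤ_[p]} {v : S}
    (hv : ∀ n : ℕ, ∃ t : ℕ, PadicInt.toZModPow n c = (t : ZMod (p ^ n)) ∧ v - (1 + a) ^ t ∈ Ideal.span {ϖ ^ (n + 1)}) :
    tEval ha (PowerSeries.binomialSeries S c) = v := by
  refine sub_eq_zero.mp (IsHausdorff.haus (inferInstance : IsHausdorff (Ideal.span {ϖ}) S) _ fun n => SModEq.zero.mpr ?_)
  rw [smul_eq_mul, Ideal.mul_top, Ideal.span_singleton_pow]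
  obtain ⟨t, hct, hvt⟩ := hv n
  have h := sub_mem (tEval_binomialSeries_sub_pow_mem ha hp hct) hvt
  rw [sub_sub_sub_cancel_right] at h
  exact Ideal.span_singleton_le_span_singleton.mpr (pow_dvd_pow ϖ (Nat.le_succ n)) h

/-- `(1+a)^{c+c′} = (1+a)^c · (1+a)^{c′}`. [cite: Washington1997, §13.2] -/
theorem tEval_binomialSeries_add (c c' : ℤ_[p]) :
    tEval ha (PowerSeries.binomialSeries S (c + c')) = tEval ha (PowerSeries.binomialSeries S c) * tEval ha (PowerSeries.binomialSeries S c') := by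
  rw [PowerSeries.binomialSeries_add, tEval_mul]

omit [IsAdicComplete (Ideal.span {ϖ}) S] in
/-- `g^k − 1 ∈ (ϖ)` when `g − 1 ∈ (ϖ)`. [cite: Serre1973CourseArithmetic, Ch. II §3.3] -/
theorem pow_sub_one_mem_span_of_sub_one_mem {g : S} (hg : g - 1 ∈ Ideal.span {ϖ}) (k : ℕ) : g ^ k - 1 ∈ Ideal.span {ϖ} :=
  Ideal.mem_span_singleton.mpr ((Ideal.mem_span_singleton.mp hg).trans (by simpa using sub_dvd_pow_sub_pow g 1 k))

/-- ★★ **Weight specialisation of a `p`-adic power**: if `v = g^c` in the sense `v ≡ g^{t_n} (mod ϖ^{n+1})`, `t_n ≡ c (mod pⁿ)` (all `n`), `g ≡ 1 (mod ϖ)`, then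
for every `k`, **`((1+T)^c)(g^k − 1) = v^k`** — evaluating the group element `g^c ↦ (1+T)^c` at the weight-`k` character `1 + T ↦ g^k` gives `(g^c)^k`
(the consistency `t_v(a_k) = v^{k+1}`, `a_k = γ^{k+1} − 1`, of the Coleman lane with `t_v = (1+T)^c`). [cite: deShalit1987, Ch. I §3.1; Ch. III §1.11 (18)]
[cite: Washington1997, §13.2] -/
theorem tEval_binomialSeries_eq_pow_of_forall (hp : (p : S) ∈ Ideal.span {ϖ}) {c : ℤ_[p]} {g v : S} (hg : g - 1 ∈ Ideal.span {ϖ})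
    (hv : ∀ n : ℕ, ∃ t : ℕ, PadicInt.toZModPow n c = (t : ZMod (p ^ n)) ∧ v - g ^ t ∈ Ideal.span {ϖ ^ (n + 1)}) (k : ℕ) :
    tEval (pow_sub_one_mem_span_of_sub_one_mem hg k) (PowerSeries.binomialSeries S c) = v ^ k := by
  refine tEval_binomialSeries_eq_of_forall _ hp fun n => ?_
  obtain ⟨t, hct, hvt⟩ := hv n
  refine ⟨t, hct, ?_⟩
  rw [add_sub_cancel, ← pow_mul, mul_comm, pow_mul]
  exact Ideal.mem_span_singleton.mpr ((Ideal.mem_span_singleton.mp hvt).trans (sub_dvd_pow_sub_pow v (g ^ t) k))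

end PadicPowersEval

end LubinTate

end Literature.NumberTheory.GaloisRepresentations

end
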